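import Literature.AnabelianGeometry.SemiGraphs.InducedAlong
import Literature.AnabelianGeometry.SemiGraphs.HomCategory

/-!
# Localizations of semi-graphs of anabelioids: the triangles `𝒢[b] → 𝒢[v] → 𝒢`, `𝒢[b] → 𝒢[e] → 𝒢` commute in the 1-category ([SemiAnbd] §1 p.13, Def 4.1) — merge step M4, part 3c

Mochizuki, *Semi-graphs of anabelioids*, Publ. RIMS **42** (2006), §1 p.13 ("we have natural
morphisms `G[b] → G[v]`, `G[b] → G[e]` over `G`") and §4 Def 4.1 p.50 (kurims
`paper:url-f33ace170ff4`). [cite: MochizukiSemiAnbd2006, Def 4.1, p. 50]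

CONSTRUCTION (L3 bridge, step M4 part 3c; cell ruling abc-iut-L3-lead 2026-08-25T20:36Z): in the
1-category `SgAQuot` of `HomCategory.lean` (arrows = 2-isomorphism classes of 1-morphisms), the
induced 1-morphism over a commutative triangle `κ ≫ ι = ι'` of morphisms of semi-graphs
(`inducedAlongMap`, `InducedAlong.lean`) composed with `𝒢_ι → 𝒢` IS `𝒢_{ι'} → 𝒢`
(`homMk_inducedAlongMap_comp`): proved over a VARIABLE `ι'` by `subst`, where a 2-cell
(`inducedAlongTriangleIso2`) with identity components exists.  Instances: the container laws
`βV_ι` / `βE_ι` of `InterfaceVocab.lean` for the real localizations —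
`homMk_atBranchToAtVertex_comp`, `homMk_atBranchToAtEdge_comp`.  Nothing printed is asserted.
-/

namespace Literature.AnabelianGeometry.SemiGraphs

open CategoryTheory Literature.AnabelianGeometry.Anabelioids

universe v₁ u₁ u

namespace SemiGraphOfAnabelioids

variable (𝒢 : SemiGraphOfAnabelioids.{v₁, u₁, u}) {H H' : SemiGraph.{u}} (ι : H ⟶ 𝒢.graph)
  (κ : H' ⟶ H)

variable {𝒢} in
/-- Components of the 2-cell of an induced 1-morphism over a triangle: an `eqToHom`.
[cite: MochizukiSemiAnbd2006, Def 4.1, p. 50] -/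
theorem inducedMapCell_hom_app (β₁ β₂ : 𝒢.graph.Branch) (hβ : β₁ = β₂) (v₁ v₂ : 𝒢.graph.Vertex)
    (hv : v₁ = v₂) (P : Anabelioids.Hom (𝒢.E (𝒢.graph.edgeOf β₁)) (𝒢.V v₁))
    (Q : Anabelioids.Hom (𝒢.E (𝒢.graph.edgeOf β₂)) (𝒢.V v₂)) (hPQ : HEq P Q)
    (E₀ E₁ : 𝒢.graph.Edge) (q : E₀ = E₁) (p : E₀ = 𝒢.graph.edgeOf β₁)
    (p' : E₁ = 𝒢.graph.edgeOf β₂) (X : 𝒢.V v₂) :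
    (inducedMapCell β₁ β₂ hβ v₁ v₂ hv P Q hPQ E₀ E₁ q p p').hom.app X =
      eqToHom (by subst hβ; subst hv; subst q; subst p; cases hPQ; rfl) := by
  subst hβ; subst hv; subst q; subst p; cases hPQ
  simp [inducedMapCell]
  erw [Category.comp_id]
  rfl

/-- The 2-cell `(𝒢_{κ ≫ ι} → 𝒢_ι) ∘→ 𝒢 ≅ (𝒢_{κ ≫ ι} → 𝒢)` (identity components; the coherence
reduces to an identity between composites of transports `eqToHom`).
[cite: MochizukiSemiAnbd2006, Def 4.1, p. 50] -/
noncomputable def inducedAlongTriangleIso2 :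
    HomOver.Iso2 ((𝒢.inducedAlongMap ι κ (κ ≫ ι) rfl).comp (𝒢.inducedAlongHomOver ι))
      (𝒢.inducedAlongHomOver (κ ≫ ι)) where
  isoV w := Functor.leftUnitor _
  isoE e e₂ h := Functor.rightUnitor _
  coh c w hc := by
    ext X
    simp only [Iso.trans_hom, NatTrans.comp_app, Functor.isoWhiskerLeft_hom,
      Functor.whiskerLeft_app, Functor.isoWhiskerRight_hom, Functor.whiskerRight_app,
      HomOver.comp, HomOver.compCell_hom_app, HomOver.compEIso_hom_app, inducedAlongMap,
      inducedAlongHomOver, inducedMapCell_hom_app, Functor.rightUnitor_hom_app,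
      Functor.leftUnitor_hom_app]
    repeat (first
      | erw [CategoryTheory.Functor.map_id]
      | erw [Category.id_comp]
      | erw [Category.comp_id]
      | erw [eqToHom_trans]
      | erw [eqToHom_refl])
    rfl

variable {𝒢 ι κ} in
/-- **In the 1-category, the induced morphism over a triangle composed with `𝒢_ι → 𝒢` is
`𝒢_{ι'} → 𝒢`** (for any presentation `κ ≫ ι = ι'`).  [cite: MochizukiSemiAnbd2006, Def 4.1, p. 50] -/
theorem homMk_inducedAlongMap_comp (ι' : H' ⟶ 𝒢.graph) (r : κ ≫ ι = ι') :
    SgAQuot.homMk ((𝒢.inducedAlongMap ι κ ι' r).comp (𝒢.inducedAlongHomOver ι)) =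
      (SgAQuot.homMk (𝒢.inducedAlongHomOver ι') :
        SgAQuot.mk (𝒢.inducedAlong ι') ⟶ SgAQuot.mk 𝒢) := by
  subst r
  exact (SgAQuot.homMk_eq_homMk_iff _ _).mpr ⟨𝒢.inducedAlongTriangleIso2 ι κ⟩

/-! ### Instances: the container laws `βV_ι`, `βE_ι` for the real localizations -/

/-- **`(𝒢[b] → 𝒢[v]) ≫ (𝒢[v] → 𝒢) = (𝒢[b] → 𝒢)`** in the 1-category (§1 p.13 "over `G`").
[cite: MochizukiSemiAnbd2006, Def 4.1, p. 50] -/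
theorem homMk_atBranchToAtVertex_comp (b : 𝒢.graph.Branch) (hb : (𝒢.graph.abuts b).isSome) :
    SgAQuot.homOf (𝒢.atBranchToAtVertex b hb) ≫
        SgAQuot.homOf (𝒢.atVertexHom ((𝒢.graph.abuts b).get hb)) =
      SgAQuot.homOf (𝒢.atBranchHom b hb) :=
  homMk_inducedAlongMap_comp (𝒢.graph.atBranchHom b hb)
    (𝒢.graph.atBranchToAtVertex_comp_atVertexHom b hb)

/-- **`(𝒢[b] → 𝒢[e]) ≫ (𝒢[e] → 𝒢) = (𝒢[b] → 𝒢)`** in the 1-category (§1 p.13 "over `G`").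
[cite: MochizukiSemiAnbd2006, Def 4.1, p. 50] -/
theorem homMk_atBranchToAtEdge_comp (b : 𝒢.graph.Branch) (hb : (𝒢.graph.abuts b).isSome) :
    SgAQuot.homOf (𝒢.atBranchToAtEdge b hb) ≫ SgAQuot.homOf (𝒢.atEdgeHom (𝒢.graph.edgeOf b)) =
      SgAQuot.homOf (𝒢.atBranchHom b hb) :=
  homMk_inducedAlongMap_comp (𝒢.graph.atBranchHom b hb) rfl

end SemiGraphOfAnabelioids

end Literature.AnabelianGeometry.SemiGraphs
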